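import Summits.CriticalPhenomena.Ising3DConformalLimit.Theses.ArmHyperscaling
import HarnessLib

/-!
# Item stmt-CriticalPhenomena-15708 `ArmHyperscaling.Assembly` — proved (it is the route's deciding theorem)

Route `ArmHyperscaling` (sub-problem `CriticalPhenomena/Ising3DConformalLimit`), assembly item (rank 1):
`OneArmHyperscaling → MergingFloor → ExistsScaleCovariantLimit → InversionUpgradeNormalised →
IsotropyFromOneArm → Ising3DConformalLimit` — exactly the hypotheses and the conclusion of the
planner-authored deciding theorem `ArmHyperscaling.closes` (rev 2, 2026-08-16: crux-only closing, the
U₄ clause being the inline limit passage of the merging floor, Aizenman–Duminil-Copin 2021 (3.11)), in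
the same order; hence pure bookkeeping, as for `ReflectionTwinAssembly.assembly_proof` and
`hyperoctahedralRP_assembly_proof`. No named facts are used. [folklore]
-/

namespace Summit.CriticalPhenomena.Ising3DConformalLimit.ArmHyperscalingAssembly

/-- **Item stmt-CriticalPhenomena-15708**: `ArmHyperscaling.Assembly`
(`OneArmHyperscaling → MergingFloor → ExistsScaleCovariantLimit → InversionUpgradeNormalised →
IsotropyFromOneArm → Ising3DConformalLimit`) is the route's deciding theorem `ArmHyperscaling.closes`:
take `ρ, Δ, S` from existence; isotropy from the one-arm input; Euclidean := ⟨translations, rotations⟩;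
inversion from the normalised upgrade; Möbius := ⟨Euclid, scale, inversion⟩; `U₄ ≢ 0` by passing the
lattice merging floor to the limit at its quadruple. [folklore] -/
theorem assembly_proof :
    Summit.CriticalPhenomena.Ising3DConformalLimit.Theses.ArmHyperscaling.Assembly :=
  Summit.CriticalPhenomena.Ising3DConformalLimit.Theses.ArmHyperscaling.closes

end Summit.CriticalPhenomena.Ising3DConformalLimit.ArmHyperscalingAssembly
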